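import Literature.NumberTheory.ComplexMultiplication.FiniteQAlgebraLatticeMaximalOrder
import Literature.NumberTheory.ComplexMultiplication.CMAlgebraLatticeTraceDual
import HarnessLib

/-!
# Over the maximal order of a separable `ℚ`-algebra every full lattice is invertible (Hertling–Larabi 2026b Thm. 4.8 (b))

[topic NumberTheory/ComplexMultiplication] General-`A` series, sequel of `FiniteQAlgebraLatticeMaximalOrder` (`Λ_max(A)`
= the `ℤ`-integral elements is an order iff `A` is separable) and `FiniteQAlgebraLatticeClassesFinite` (Thm. 6.3 for
separable `A`). Sources, VERBATIM:

C. Hertling, K. Larabi, *Conjugacy classes of regular integer matrices*, arXiv:2602.15748 (2026) [HertlingLarabi2026b],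
§4, chunks p0007–p0008: «Theorem 4.3 (DTZ62). [Fa65-1] [HL26] […] (b) Let `L ∈ 𝓛(A)`. The following four properties
are equivalent: (i) `L` is invertible in the semigroup `𝓛(A)`. (ii) `L_2 ∈ 𝓛(A)` with `L·L_2 = 𝒪(L)` exists.
(iii) `L·(𝒪(L):L) = 𝒪(L)`. (iv) `𝒪(𝒪(L):L) = 𝒪(L)`.» («the implication (iv)⇒(i) in Theorem 4.3 (b)» is «from
[Fa65-1]»); «Theorem 4.8. Let `A` be separable. (a) Then there is a maximal order `Λ_max` in `A`. (b) Each full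
lattice `L` with `𝒪(L) = Λ_max` is invertible. Proof: […] If `L` is a full lattice with `𝒪(L) = Λ_max`, then
`L·1_{A^{(j)}}` is a full lattice in `A^{(j)}` with `𝒪(L·1_{A^{(j)}}) = Λ_max(A^{(j)})`, so it is invertible in
`A^{(j)}`. We have `L = ⊕_{j=1}^k L·1_{A^{(j)}}` because `1_{A^{(j)}} ∈ Λ_max`. Therefore `L` is invertible in `A`.»

C. Hertling, K. Larabi, *Semigroups from full lattices in commutative ℚ-algebras*, arXiv:2602.14973 (2026)
[HertlingLarabi2026], §6 Cor. 6.2, chunk p0015: «(b) Each full lattice `L` with `𝒪(L) = Λ_max(A)` is […] invertible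
[…]. (c) The group `G([Λ_max]_ε)` is finite and isomorphic to the product `∏_{j=1}^k G([Λ_max(A^{(j)})]_ε)` of the
class groups of the algebraic numbers fields `A^{(1)}, ..., A^{(k)}`.»

In the tree: for the literal product `Y = L_1 ⊕ ⋯ ⊕ L_t` of number fields, (iv)⇒(iii) is
`CMAlgebraLatticeTraceDual.mul_div_div_eq_of_div_div_div_eq` (via the trace dual) and Cor. 6.2 (b) is
`mul_div_eq_of_div_self_eq_pi`. Here both are moved to an ARBITRARY separable (= reduced) finite-dimensional
commutative `ℚ`-algebra `A` along `A ≅ ∏_𝔪 A/𝔪` (Mathlib's `IsArtinianRing.equivPi`), which requires the transport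
of products and quotients of lattices (§1).

## What is formalised (`Λ_max(A) := Subalgebra.toSubmodule (integralClosure ℤ A)`, never named; `𝒪(L) = L/L`)

* §1 (any rings) a ring isomorphism `e` maps `MN ↦ e(M)e(N)`, `M:N ↦ e(M):e(N)` and is injective on lattices
  (`map_mul_eq`, `map_div_eq`, `map_injective`).
* §2 **THEOREM 4.3 (b) (iv)⇒(iii) for separable `A`**: `𝒪(𝒪(L):L) = 𝒪(L) ⟹ L·(𝒪(L):L) = 𝒪(L)`
  (`mul_div_div_eq_of_div_div_div_eq_of_isReduced`).
* §3 **THEOREM 4.8 (b) / COROLLARY 6.2 (b)**: `Λ_max`-stable full lattices have order exactly `Λ_max`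
  (`div_self_eq_integralClosure_of_forall_mul_mem`, any `A`), and for separable `A` a full `L` with `𝒪(L) = Λ_max`
  satisfies `L·(Λ_max:L) = Λ_max` (`mul_div_eq_of_div_self_eq_integralClosure`); **COROLLARY 6.2 (c), finiteness
  clause**: the `ε`-classes of full `Λ_max`-stable lattices — all invertible — form a finite type
  (`finite_quot_isFullLattice_integralClosure`).
NOT here: the product decomposition `G([Λ_max]_ε) ≅ ∏_j G([Λ_max(A^{(j)})]_ε)` of Cor. 6.2 (c), Thm. 4.9 (BF65).

## References
* [HertlingLarabi2026b] C. Hertling, K. Larabi, arXiv:2602.15748 (2026), §4 Thm. 4.3 (b), Thm. 4.8 (b).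
  [cite: HertlingLarabi2026b, §4 Thm. 4.8 (b), chunks p0007–p0008]
* [HertlingLarabi2026] C. Hertling, K. Larabi, arXiv:2602.14973 (2026), §6 Cor. 6.2 (b)(c).
  [cite: HertlingLarabi2026, §6 Cor. 6.2 (b)(c), chunk p0015]
* [DadeTausskyZassenhaus1962] E. C. Dade, O. Taussky, H. Zassenhaus, Math. Ann. 148 (1962) (Thm. 4.3 «(DTZ62)»).
-/

noncomputable section

open scoped Classical Pointwise
open Submodule Module

namespace Literature.NumberTheory.ComplexMultiplication.FiniteQAlgebraLattice

open Literature.NumberTheory.Automorphic (IsFullLattice)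
open Literature.LinearAlgebra.Matrix.LatimerMacDuffeeSquarefree (isFullLattice_map finite_quot_of_ringEquiv)

/-! ## §1 Transport of products and quotients of lattices along a ring isomorphism -/

section Transport

variable {B B' : Type*} [CommRing B] [CommRing B']

/-- `e(MN) = e(M)e(N)`: a ring isomorphism «respects addition, multiplication and division» of full lattices
(said of `pr_F` in HL26b Thm. 3.1 (ii); used for the summands `L·1_{A^{(j)}}` in the proof of Thm. 4.8).
[cite: HertlingLarabi2026b, §3 Thm. 3.1 (ii) and §4 Thm. 4.8 (proof), chunks p0006, p0008] -/
theorem map_mul_eq (e : B ≃+* B') (M N : Submodule ℤ B) :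
    (M * N).map (e : B →+ B').toIntLinearMap =
      M.map (e : B →+ B').toIntLinearMap * N.map (e : B →+ B').toIntLinearMap := by
  have h : (e : B →+ B').toIntLinearMap = ((e : B →+* B').toIntAlgHom).toLinearMap :=
    LinearMap.ext fun _ => rfl
  rw [h, Submodule.map_mul]

/-- `e(M:N) = e(M):e(N)`: a ring isomorphism «respects […] division» of full lattices.
[cite: HertlingLarabi2026b, §3 Thm. 3.1 (ii) and §4 Thm. 4.8 (proof), chunks p0006, p0008] -/
theorem map_div_eq (e : B ≃+* B') (M N : Submodule ℤ B) :
    (M / N).map (e : B →+ B').toIntLinearMap =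
      M.map (e : B →+ B').toIntLinearMap / N.map (e : B →+ B').toIntLinearMap := by
  ext y
  simp only [Submodule.mem_map, Submodule.mem_div_iff_forall_mul_mem]
  constructor
  · rintro ⟨x, hx, rfl⟩ _ ⟨n, hn, rfl⟩
    exact ⟨x * n, hx n hn, by simp⟩
  · intro hy
    refine ⟨e.symm y, fun n hn => ?_, by simp⟩
    obtain ⟨z, hz, hzy⟩ := hy _ ⟨n, hn, rfl⟩
    have : z = e.symm y * n := by
      apply e.injective
      simp only [map_mul, RingEquiv.apply_symm_apply]
      simpa using hzy
    rw [← this]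
    exact hz

/-- `M ↦ e(M)` is injective. [folklore] -/
private theorem map_injective (e : B ≃+* B') :
    Function.Injective (Submodule.map (e : B →+ B').toIntLinearMap : Submodule ℤ B → Submodule ℤ B') :=
  Submodule.map_injective_of_injective (f := (e : B →+ B').toIntLinearMap) e.injective

end Transport

variable {A : Type} [CommRing A] [Algebra ℚ A] [Module.Finite ℚ A]

/-! ## §2 Theorem 4.3 (b) (iv)⇒(iii) for separable `A` -/

/-- **THEOREM 4.3 (b) (iv)⇒(iii) [Fa65-1] for SEPARABLE `A`: for a full lattice `L` of a reduced finite-dimensional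
commutative `ℚ`-algebra, `𝒪(𝒪(L):L) = 𝒪(L)` implies `L·(𝒪(L):L) = 𝒪(L)`** (so `L` is invertible) — transported
from the `Y`-theorem (trace dual) along `A ≅ ∏_𝔪 A/𝔪`. [cite: HertlingLarabi2026b, §4 Thm. 4.3 (b) (iii)(iv), chunk p0007]
[cite: HertlingLarabi2026, §5 Thm. 5.6 (c) (iii) ⟺ (v), chunk p0012] [cite: DadeTausskyZassenhaus1962, title theorem] -/
theorem mul_div_div_eq_of_div_div_div_eq_of_isReduced [IsReduced A] {M : Submodule ℤ A} (hM : IsFullLattice A M)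
    (hv : ((M / M) / M) / ((M / M) / M) = M / M) : M * ((M / M) / M) = M / M := by
  haveI : IsArtinianRing A := IsArtinianRing.of_finite ℚ A
  letI : Fintype (MaximalSpectrum A) := Fintype.ofFinite _
  letI : ∀ i : MaximalSpectrum A, Field (A ⧸ i.asIdeal) := fun i => Ideal.Quotient.field i.asIdeal
  haveI : ∀ i : MaximalSpectrum A, NumberField (A ⧸ i.asIdeal) := fun i =>
    { to_charZero := algebraRat.charZero (A ⧸ i.asIdeal)
      to_finiteDimensional := by
        convert! (inferInstance : Module.Finite ℚ (A ⧸ i.asIdeal))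
        exact Subsingleton.elim _ _ }
  let e : A ≃+* (Π i : MaximalSpectrum A, A ⧸ i.asIdeal) := (IsArtinianRing.equivPi A).toRingEquiv
  have hM' := isFullLattice_map e hM
  have hv' := congrArg (Submodule.map (e : A →+ Π i : MaximalSpectrum A, A ⧸ i.asIdeal).toIntLinearMap) hv
  simp only [map_div_eq] at hv'
  have h := mul_div_div_eq_of_div_div_div_eq (L := fun i : MaximalSpectrum A => A ⧸ i.asIdeal) hM' hv'
  refine map_injective e ?_
  simp only [map_mul_eq, map_div_eq]
  exact h

/-! ## §3 Theorem 4.8 (b) / Corollary 6.2 (b)(c) -/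

omit [Module.Finite ℚ A] in
/-- **COROLLARY 6.2 (b), first clause, for any `A`: a full lattice `M` with `MΛ_max ⊆ M` has order EXACTLY `Λ_max`**
(`𝒪(M) ⊆ Λ_max` always, `FiniteQAlgebraLatticeMaximalOrder.div_self_le_toSubmodule_integralClosure`).
[cite: HertlingLarabi2026, §6 Thm. 6.1 (b), Cor. 6.2 (b), chunk p0015] -/
theorem div_self_eq_integralClosure_of_forall_mul_mem {M : Submodule ℤ A} (hM : IsFullLattice A M)
    (h : ∀ m ∈ M, ∀ a ∈ Subalgebra.toSubmodule (integralClosure ℤ A), m * a ∈ M) :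
    M / M = Subalgebra.toSubmodule (integralClosure ℤ A) :=
  le_antisymm (div_self_le_toSubmodule_integralClosure hM) fun a ha =>
    Submodule.mem_div_iff_forall_mul_mem.2 fun m hm => by
      rw [mul_comm]
      exact h m hm a ha

/-- **THEOREM 4.8 (b) / COROLLARY 6.2 (b): «Each full lattice `L` with `𝒪(L) = Λ_max` is invertible» — for separable
`A`, `L·(Λ_max:L) = Λ_max`** (transport of the tree's `mul_div_eq_of_div_self_eq_pi` along `A ≅ ∏_𝔪 A/𝔪`, under
which `Λ_max(A) ↦ ⊕ 𝒪_{A/𝔪}`). [cite: HertlingLarabi2026b, §4 Thm. 4.8 (b), chunk p0008] [cite: HertlingLarabi2026, §6 Cor. 6.2 (b), chunk p0015] -/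
theorem mul_div_eq_of_div_self_eq_integralClosure [IsReduced A] {M : Submodule ℤ A} (hM : IsFullLattice A M)
    (hO : M / M = Subalgebra.toSubmodule (integralClosure ℤ A)) :
    M * (Subalgebra.toSubmodule (integralClosure ℤ A) / M) = Subalgebra.toSubmodule (integralClosure ℤ A) := by
  haveI : IsArtinianRing A := IsArtinianRing.of_finite ℚ A
  letI : Fintype (MaximalSpectrum A) := Fintype.ofFinite _
  letI : ∀ i : MaximalSpectrum A, Field (A ⧸ i.asIdeal) := fun i => Ideal.Quotient.field i.asIdeal
  haveI : ∀ i : MaximalSpectrum A, NumberField (A ⧸ i.asIdeal) := fun i =>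
    { to_charZero := algebraRat.charZero (A ⧸ i.asIdeal)
      to_finiteDimensional := by
        convert! (inferInstance : Module.Finite ℚ (A ⧸ i.asIdeal))
        exact Subsingleton.elim _ _ }
  let e : A ≃+* (Π i : MaximalSpectrum A, A ⧸ i.asIdeal) := (IsArtinianRing.equivPi A).toRingEquiv
  have hM' := isFullLattice_map e hM
  have hO' := congrArg (Submodule.map (e : A →+ Π i : MaximalSpectrum A, A ⧸ i.asIdeal).toIntLinearMap) hO
  rw [map_div_eq, map_toSubmodule_integralClosure_eq_pi e] at hO'
  have h := mul_div_eq_of_div_self_eq_pi (L := fun i : MaximalSpectrum A => A ⧸ i.asIdeal) hM' hO'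
  refine map_injective e ?_
  rw [map_mul_eq, map_div_eq, map_toSubmodule_integralClosure_eq_pi e]
  exact h

/-- **THEOREM 4.8 (b) with COR. 6.2 (b), stable form: for separable `A`, every full lattice `M` with `MΛ_max ⊆ M` is
invertible with `𝒪(M) = Λ_max`: `M·(Λ_max:M) = Λ_max = 𝒪(M)`.** [cite: HertlingLarabi2026b, §4 Thm. 4.8 (b), chunk p0008]
[cite: HertlingLarabi2026, §6 Cor. 6.2 (b), chunk p0015] -/
theorem mul_div_eq_of_forall_mul_mem_integralClosure [IsReduced A] {M : Submodule ℤ A} (hM : IsFullLattice A M)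
    (h : ∀ m ∈ M, ∀ a ∈ Subalgebra.toSubmodule (integralClosure ℤ A), m * a ∈ M) :
    M / M = Subalgebra.toSubmodule (integralClosure ℤ A) ∧ M * ((M / M) / M) = M / M := by
  have hO := div_self_eq_integralClosure_of_forall_mul_mem hM h
  refine ⟨hO, ?_⟩
  rw [hO]
  exact mul_div_eq_of_div_self_eq_integralClosure hM hO

/-- **COROLLARY 6.2 (c), finiteness clause: «The group `G([Λ_max]_ε)` is finite»** — for separable `A` the
`ε`-classes of full lattices `M` with `MΛ_max ⊆ M` (all of order `Λ_max` and invertible, see above) form a finite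
type (Theorem 6.3 for the order `Λ_max`, `FiniteQAlgebraLatticeClassesFinite`). [cite: HertlingLarabi2026, §6 Cor. 6.2 (c) and Thm. 6.3, chunk p0015] -/
theorem finite_quot_isFullLattice_integralClosure [IsReduced A] :
    Finite (Quot fun M M' : {M : Submodule ℤ A // IsFullLattice A M ∧
        ∀ m ∈ M, ∀ a ∈ Subalgebra.toSubmodule (integralClosure ℤ A), m * a ∈ M} => ∃ u : Aˣ, u • M.1 = M'.1) :=
  finite_quot_isFullLattice_of_isReduced _ isFullLattice_toSubmodule_integralClosure_of_isReduced

end Literature.NumberTheory.ComplexMultiplication.FiniteQAlgebraLattice
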